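import Summits.BirchSwinnertonDyer.BirchSwinnertonDyer.Theorems.KolyvaginRankRigidityAtTwoSignedRefillAtKolyvaginPlace
import Summits.BirchSwinnertonDyer.BirchSwinnertonDyer.Theorems.KolyvaginRankRigidityAtTwoWalkBridge
import Summits.BirchSwinnertonDyer.BirchSwinnertonDyer.Theorems.KolyvaginRankRigidityAtTwoSwapOfNamedFacts
import Summits.BirchSwinnertonDyer.BirchSwinnertonDyer.Theorems.KolyvaginRankRigidityAtTwoSwapWeilDatumLiftChange
import Summits.BirchSwinnertonDyer.BirchSwinnertonDyer.Theorems.PoitouTateSelmerStructureDualityConjHolds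
import Summits.BirchSwinnertonDyer.Rank1Residual.X11b.KolyvaginHpointsAssembly
import HarnessLib

/-!
# Crux U1 `KolyvaginBoundedDefectAtTwo` (stmt-BirchSwinnertonDyer-28083), LINE 17 `kolyvagin_swap` —
# SRS · SIGNED REFILL SUPPLY AT 2 (pen bsd-idea-1 v7.7, `line17/kolyvagin_swap_v77.lean` sha16 55dfebd9, l.587–597,
# the typed sub-target «SRS `SignedRefillSupplyAtTwo`» of SWα, price M) — PROVED, constant `C = 7`

Width seat `bsd-line-krr2-p2` g18 (ONE READER on LINE 17); `--supports stmt-BirchSwinnertonDyer-28083` (helper).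
HONEST FRAMING: SRS is a typed SUB-TARGET of the pen's (unregistered) v7.7 decomposition of SWα, not a registered stub of the
line of record v7.2r; nothing here proves SWα, Zζ, U1, a rung or BSD. BSD is NOT proved.

## Statement
`signedRefillSupplyAtTwo` is the body of the pen's `SignedRefillSupplyAtTwo` BYTE-FOR-BYTE with its one defined term
`OppShape W K ι τ M e u a 0` (the shape `Sh(0, a)` of the `(−u)`-part of `H_{𝓕(e)}`, v7.4 l.358–368) UNFOLDED (the v7.x
definitions live in the pen's HOME file / the Cruxes tree, not in an importable module): on U1's habitat, for `τ ≠ 1`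
and `u = ±1`, THERE IS `C` (here `C = 7`) such that for all `a M q e` with `qe` a square-free Kolyvagin conductor, `q` a
prime not dividing `e`, `1 ≤ M`, MARGIN ONE `M + 1 ≤ M(qe)`, shape `Sh(0,a)` at `e` in sign `−u`, and `a + C < M`:
some `z ∈ H_{𝓕(qe)}(K, E[2^M])` (`Jetchev2008.modifiedSelmerGroup … (q*e)`) is an EXACT `(−u)`-eigenclass with
`2^(M − (a+C) − 1) • z ≠ 0`. When the pen's `OppShape` is in scope, `stub_signedRefillSupplyAtTwo` closes by `exact`
(definitional unfolding).

## Proof (assembly of this seat's two files + the lineage's frame dictionary)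
`s := −u`; conductor `c := e·q`, place `v = (q)` (inert, `τ`-fixed); Weil datum `exists_weilDatum_liftAut_two_pow` moved to
the place lift (`weil_equivariant_of_isLiftOfAut`); Poitou–Tate package `poitouTate_selmerStructure_duality_conj_holds`
(perfect, reciprocity, Selmer complement, conjugation-compatible); the transverse family of `e·q` by its defining
formula; `H¹_{𝓕(eq)[v ↦ Kum_v]} = H_{𝓕(e)}` and `H¹_{𝓕(eq)} = H_{𝓕(eq)}` (g15 `selmerGroup_update_kummer_eq_modifiedSelmerGroup`,
`selmerGroup_selmerF_eq_modifiedSelmerGroup_of_dvd`); the cut hypothesis of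
`exists_eigen_mem_selmerF_of_symmetrised_cut` from the shape clause applied to the symmetrised class `τy + s y ∈ H_{𝓕(e)}`
(`conjAct_mem_modifiedSelmerGroup`) and Φ-KILL at `v` (index `≥ M + 1`, `RegularWalk.localization_eq_zero_of_res_eq_zero`).
References (locators only; no cited FACT is declared): [cite: MazurRubin2004, §4.1 Prop. 4.1.5, Lemma 4.1.7]
[cite: Howard2004HeegnerKolyvagin, §1.5–1.6, Thm. 2.1.11] [cite: Jetchev2008, §3.2 (2), §3.4.1, Lemma 5.2 (iii)]
[cite: GrossLMS1991, §3 (3.3)–(3.4), §9 Prop. 9.1] [cite: PoonenRains2012, Prop. 4.10–4.11].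
Design: no definitions; `K : Type`; axioms `propext`, `Classical.choice`, `Quot.sound`.
-/

set_option autoImplicit false
-- the Theorems namespace of this sub repeats the summit name by design (D-0017 nested layout)
set_option linter.dupNamespace false

noncomputable section

open scoped Classical
open Function NumberField IsDedekindDomain WeierstrassCurve Field Finset
open Literature.NumberTheory.EllipticCurves Literature.NumberTheory.EllipticCurves.Jetchev2008
open Literature.NumberTheory.EllipticCurves.KolyvaginPairing
open Literature.NumberTheory.GaloisRepresentations Literature.NumberTheory.GaloisCohomology
open Literature.NumberTheory.GaloisRepresentations.DiscreteGaloisModule (transverseSubgroup SelmerStructure)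
open Literature.NumberTheory.Automorphic Literature.NumberTheory
open Summit.BirchSwinnertonDyer.Rank1Residual
open Summit.BirchSwinnertonDyer.Rank1Residual.JET.SelmerVocabulary
open Summit.BirchSwinnertonDyer.Rank1Residual.JET.GlobalDuality (smul_place_eq_self_of_natCast_mem)
open Summit.BirchSwinnertonDyer.BirchSwinnertonDyer.Theorems.KolyvaginLowerBoundAtTwo (exists_weilDatum_liftAut_two_pow
  weil_equivariant_of_isLiftOfAut)

namespace Summit.BirchSwinnertonDyer.BirchSwinnertonDyer.Theorems.KolyvaginAtTwo.RegularWalk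

set_option maxHeartbeats 800000 in
/-- **SRS `SignedRefillSupplyAtTwo` (pen v7.7, VERBATIM with `OppShape … 0` unfolded), `C = 7`.** On U1's habitat, for the
complex conjugation `τ` and a sign `u`: if the `(−u)`-part of the engine Selmer group `H_{𝓕(e)}(K, E[2^M])` has shape
`Sh(0, a)` (no exact `(−u)`-class beyond `2^a` modulo phantoms on `Γ_{K(E[2^(M+1)])}`) and `q ∤ e` is a seed prime (`qe`
square-free Kolyvagin, margin one), `a + 7 < M`, then `H_{𝓕(qe)}` contains an EXACT `(−u)`-eigenclass `z` with
`2^(M − (a + 7) − 1) • z ≠ 0`. See the module docstring for the proof map.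
[cite: MazurRubin2004, §4.1 Prop. 4.1.5, Lemma 4.1.7] [cite: Howard2004HeegnerKolyvagin, §1.5–1.6]
[cite: GrossLMS1991, §9] [cite: PoonenRains2012, §2, §4] -/
theorem signedRefillSupplyAtTwo :
    ∀ (W : WeierstrassCurve ℚ) [W.IsElliptic] [W.IsGloballyMinimal], ¬ W.HasCM → (Literature.NumberTheory.EllipticCurves.Rank1Residual.GoodOrd W 2 ∨ Literature.NumberTheory.EllipticCurves.Rank1Residual.Mult W 2) → (∀ m : ℕ, W.HasSurjectiveModNGaloisRep (2 ^ m : ℕ)) → ∀ (K : Type) [Field K] [NumberField K], Literature.NumberTheory.EllipticCurves.IsImaginaryQuadratic K → ∀ [NeZero (W.conductorNorm ℤ)], Literature.NumberTheory.EllipticCurves.SatisfiesHeegnerHypothesis (W.conductorNorm ℤ) K → Odd (NumberField.discr K) → NumberField.discr K ≠ -3 → AddSubgroup.torsionBy (W.baseChange K).toAffine.Point (2 : ℤ) = ⊥ → Literature.NumberTheory.EllipticCurves.SatisfiesHeegnerHypothesis 2 K → ∀ (Dt : Literature.NumberTheory.EllipticCurves.ModularForms.ModularParametrizationData W (W.conductorNorm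 ℤ)) (β : ℤ) (ι : K →+* ℂ) [∀ k : ℕ, NumberField (ringClassField K ι k)], (4 * (W.conductorNorm ℤ : ℤ)) ∣ β ^ 2 - NumberField.discr K →
    ∀ (τ : K ≃ₐ[ℚ] K), τ ≠ 1 → ∀ (u : ℤ), (u = 1 ∨ u = -1) →
    ∃ C : ℕ, ∀ (a M q e : ℕ),
      Literature.NumberTheory.EllipticCurves.KolyvaginDescent.KolSupp (Literature.NumberTheory.EllipticCurves.Zhang2014.IsKolyvaginPrime (W.conductorNorm ℤ) W K 2) (q * e) →
      q.Prime → ¬ q ∣ e → 1 ≤ M → (((M + 1 : ℕ) : ℕ) : ℕ∞) ≤ Literature.NumberTheory.EllipticCurves.Zhang2014.levelIndex W 2 (q * e) →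
      (∃ (g : Fin 0 → galH1Torsion (W.baseChange K) ((2 ^ M : ℕ) : ℤ)),
        (∀ i, g i ∈ Jetchev2008.modifiedSelmerGroup W K ι ((2 ^ M : ℕ) : ℤ) e) ∧
        (∀ i, conjAct W τ ((2 ^ M : ℕ) : ℤ) (g i) = (-u) • g i) ∧
        (∀ b : Fin 0 → ℤ, (∀ σ ∈ torsionFixing (W.baseChange K) ((2 ^ (M + 1) : ℕ) : ℤ),
            h1Eval (W.baseChange K) ((2 ^ M : ℕ) : ℤ) (∑ i, b i • g i) σ = 0) → ∀ i, (2 : ℤ) ^ (M - a) ∣ b i) ∧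
        (∀ y : galH1Torsion (W.baseChange K) ((2 ^ M : ℕ) : ℤ), y ∈ Jetchev2008.modifiedSelmerGroup W K ι ((2 ^ M : ℕ) : ℤ) e →
          conjAct W τ ((2 ^ M : ℕ) : ℤ) y = (-u) • y →
          ∃ b : Fin 0 → ℤ, ∀ σ ∈ torsionFixing (W.baseChange K) ((2 ^ (M + 1) : ℕ) : ℤ),
            h1Eval (W.baseChange K) ((2 ^ M : ℕ) : ℤ) (((2 : ℤ) ^ a) • y - ∑ i, b i • g i) σ = 0)) →
      a + C < M →
      ∃ z : galH1Torsion (W.baseChange K) ((2 ^ M : ℕ) : ℤ),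
        z ∈ Jetchev2008.modifiedSelmerGroup W K ι ((2 ^ M : ℕ) : ℤ) (q * e) ∧
        conjAct W τ ((2 ^ M : ℕ) : ℤ) z = (-u) • z ∧
        ((2 ^ (M - (a + C) - 1) : ℕ) : ℤ) • z ≠ 0 := by
  intro W _ _ hCM hred hsur K _ _ hK _ hH hodd hd3 htors hH2 Dt β ι _ hβ τ hτ1 u hu
  classical
  refine ⟨7, fun a M q e' hKol hq hqe hM hidx hshape haC ↦ ?_⟩
  obtain ⟨g, -, -, -, hsmall⟩ := hshape
  -- instances and the frame data at level `2^M`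
  haveI : NeZero (2 ^ M) := ⟨pow_ne_zero M two_ne_zero⟩
  haveI hEK : (W.baseChange K).IsElliptic := by rw [baseChange]; infer_instance
  haveI : Finite (geomTorsion (W.baseChange K) ((2 ^ M : ℕ) : ℤ)) := finite_geomTorsion_of_neZero (W.baseChange K) (2 ^ M)
  have hs : (-u = 1 ∨ -u = -1) := by rcases hu with rfl | rfl <;> norm_num
  have hne4 : NumberField.discr K ≠ -4 := fun h ↦ by rw [h] at hodd; exact absurd hodd (by decide)
  have hD : NumberField.discr K < -4 := X11b.KolyvaginAssembly.discr_lt_neg_four hK ⟨hd3, hne4⟩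
  obtain ⟨inv, hperf, hvan, -, hSC, hconj⟩ := InputsPoitouTateSelmer.poitouTate_selmerStructure_duality_conj_holds K (2 ^ M)
  obtain ⟨ew, hμ, hadd₁, hadd₂, hgal, halt, hnondeg, hτe⟩ := exists_weilDatum_liftAut_two_pow (K := K) W τ M
  -- the conductor `c = e·q` and the seed place `v ∣ q`
  have hn0 : q * e' ≠ 0 := hKol.1.ne_zero
  have hc : Squarefree (e' * q) := by rw [mul_comm]; exact hKol.1
  have hqmem : q ∈ (q * e').primeFactors := Nat.mem_primeFactors.mpr ⟨hq, dvd_mul_right q e', hn0⟩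
  have hKolq : Zhang2014.IsKolyvaginPrime (W.conductorNorm ℤ) W K 2 q := hKol.2 q hqmem
  have hidx' : ∀ ℓ ∈ (q * e').primeFactors, M + 1 ≤ Zhang2014.kolyvaginIndex W 2 ℓ :=
    Zhang2014.natCast_le_levelIndex_iff.mp hidx
  have hkol : ∀ ℓ ∈ (e' * q).primeFactors, Zhang2014.IsKolyvaginPrime (W.conductorNorm ℤ) W K 2 ℓ := fun ℓ hℓ ↦
    hKol.2 ℓ (by rwa [mul_comm] at hℓ)
  have hkM : ∀ ℓ ∈ (e' * q).primeFactors, M + 1 ≤ Zhang2014.kolyvaginIndex W 2 ℓ := fun ℓ hℓ ↦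
    hidx' ℓ (by rwa [mul_comm] at hℓ)
  have hqmem' : q ∈ (e' * q).primeFactors := by rw [mul_comm]; exact hqmem
  obtain ⟨v, hv⟩ := exists_place_natCast_mem_of_kolyvaginPrime W hKolq
  have hfix : τ • v = v := smul_place_eq_self_of_natCast_mem τ hq.ne_zero hKolq.2.2.2.2.1 v hv
  have hτe' : ∀ S T, liftAutPlace τ hfix (ew S T) =
      ew ((isLiftOfAut_liftAutPlace τ hfix).torsionMap W ((2 ^ M : ℕ) : ℤ) S)
        ((isLiftOfAut_liftAutPlace τ hfix).torsionMap W ((2 ^ M : ℕ) : ℤ) T) :=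
    weil_equivariant_of_isLiftOfAut W ((2 ^ M : ℕ) : ℤ) (isLiftOfAut_liftAutPlace τ hfix) (isLiftOfAut_liftAut τ)
      ew hgal hτe
  -- the transverse family of `e·q` by its defining formula
  let 𝒯' : SelmerStructure ((W.baseChange K).torsionGaloisModule ((2 ^ M : ℕ) : ℤ)) := fun w ↦ match w with
    | Sum.inl _ => ⊤
    | Sum.inr w => ⨅ ℓ' ∈ (e' * q).primeFactors.filter (fun ℓ' : ℕ ↦ ((ℓ' : ℕ) : 𝓞 K) ∈ w.asIdeal),
        ⨅ (w' : HeightOneSpectrum (𝓞 (ringClassField K ι ℓ'))) (_ : w'.asIdeal.LiesOver w.asIdeal),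
          letI := (adicCompletionOfLiesOver K (ringClassField K ι ℓ') w w').toAlgebra
          transverseSubgroup (GaloisRep.toLocal w ((W.baseChange K).torsionGaloisModule ((2 ^ M : ℕ) : ℤ)))
            (w'.adicCompletion (ringClassField K ι ℓ'))
  have h𝒯' : ∀ w : HeightOneSpectrum (𝓞 K), 𝒯' (Sum.inr w) =
      ⨅ ℓ' ∈ (e' * q).primeFactors.filter (fun ℓ' : ℕ ↦ ((ℓ' : ℕ) : 𝓞 K) ∈ w.asIdeal),
        ⨅ (w' : HeightOneSpectrum (𝓞 (ringClassField K ι ℓ'))) (_ : w'.asIdeal.LiesOver w.asIdeal),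
          letI := (adicCompletionOfLiesOver K (ringClassField K ι ℓ') w w').toAlgebra
          transverseSubgroup (GaloisRep.toLocal w ((W.baseChange K).torsionGaloisModule ((2 ^ M : ℕ) : ℤ)))
            (w'.adicCompletion (ringClassField K ι ℓ')) := fun w ↦ rfl
  set 𝓛 := selmerF W ((2 ^ M : ℕ) : ℤ) 𝒯' (placesDividing K (e' * q)) with h𝓛def
  -- the two vertices in the walk's currency
  have hS'eq : 𝓛.selmerGroup = modifiedSelmerGroup W K ι ((2 ^ M : ℕ) : ℤ) (e' * q) :=
    selmerGroup_selmerF_eq_modifiedSelmerGroup_of_dvd W ι _ hc dvd_rfl 𝒯' h𝒯'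
  have hSeq : SelmerStructure.selmerGroup (Function.update 𝓛 (Sum.inr v : Place K)
        ((W.baseChange K).kummerSelmerStructure ((2 ^ M : ℕ) : ℤ) (Sum.inr v : Place K)) :
        SelmerStructure ((W.baseChange K).torsionGaloisModule ((2 ^ M : ℕ) : ℤ))) =
      modifiedSelmerGroup W K ι ((2 ^ M : ℕ) : ℤ) e' :=
    selmerGroup_update_kummer_eq_modifiedSelmerGroup W ι _ hc hq hKolq.2.2.2.2.1 hv 𝒯' h𝒯'
  -- `loc_v` in the `galH1Torsion` spelling
  let loc : galH1Torsion (W.baseChange K) ((2 ^ M : ℕ) : ℤ) →+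
      galoisCohomology (((W.baseChange K).torsionGaloisModule ((2 ^ M : ℕ) : ℤ)).toLocal (Sum.inr v : Place K)) 1 :=
    galoisCohomology.localization ((W.baseChange K).torsionGaloisModule ((2 ^ M : ℕ) : ℤ)) (Sum.inr v : Place K) 1
  -- the cut hypothesis: the shape `Sh(0, a)` read through Φ-KILL at `v`
  have hcut : ∀ y ∈ (SelmerStructure.selmerGroup (Function.update 𝓛 (Sum.inr v : Place K)
        ((W.baseChange K).kummerSelmerStructure ((2 ^ M : ℕ) : ℤ) (Sum.inr v : Place K)) :
        SelmerStructure ((W.baseChange K).torsionGaloisModule ((2 ^ M : ℕ) : ℤ)))),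
      (2 : ℤ) ^ a • (conjActPlace W τ ((2 ^ M : ℕ) : ℤ) hfix
          (galoisCohomology.localization ((W.baseChange K).torsionGaloisModule ((2 ^ M : ℕ) : ℤ)) (Sum.inr v : Place K) 1 y) +
        (-u) • galoisCohomology.localization ((W.baseChange K).torsionGaloisModule ((2 ^ M : ℕ) : ℤ))
          (Sum.inr v : Place K) 1 y) = 0 := by
    intro y hy
    rw [hSeq] at hy
    obtain ⟨y', rfl⟩ : ∃ y' : galH1Torsion (W.baseChange K) ((2 ^ M : ℕ) : ℤ), y' = y := ⟨y, rfl⟩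
    have hττ : τ * τ = 1 := by
      haveI : Algebra.IsQuadraticExtension ℚ K := ⟨hK.1⟩
      have hcard : Nat.card (K ≃ₐ[ℚ] K) = 2 := by rw [IsGalois.card_aut_eq_finrank, hK.1]
      haveI : Finite (K ≃ₐ[ℚ] K) := Nat.finite_of_card_ne_zero (by rw [hcard]; decide)
      have h : τ ^ Nat.card (K ≃ₐ[ℚ] K) = 1 := pow_card_eq_one'
      rw [hcard, pow_two] at h
      exact h
    have hss : (-u) * (-u) = 1 := by rcases hu with rfl | rfl <;> norm_num
    -- the symmetrised class `y'' = τ y' + s y' ∈ H_{𝓕(e)}` is an exact `(−u)`-eigenclass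
    have he'sq : Squarefree e' := hc.squarefree_of_dvd (dvd_mul_right e' q)
    have hy''S : conjAct W τ ((2 ^ M : ℕ) : ℤ) y' + (-u) • y' ∈ modifiedSelmerGroup W K ι ((2 ^ M : ℕ) : ℤ) e' :=
      AddSubgroup.add_mem _ (conjAct_mem_modifiedSelmerGroup W hK ι M he'sq hy τ) (AddSubgroup.zsmul_mem _ hy _)
    have hy''eig : conjAct W τ ((2 ^ M : ℕ) : ℤ) (conjAct W τ ((2 ^ M : ℕ) : ℤ) y' + (-u) • y') =
        (-u) • (conjAct W τ ((2 ^ M : ℕ) : ℤ) y' + (-u) • y') := by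
      rw [map_add, map_zsmul, conjAct_conjAct_of_mul_self W hττ]
      rcases hs with h1 | h1 <;> rw [h1]
      · simp only [one_zsmul]
        exact add_comm _ _
      · simp only [neg_one_zsmul, neg_add, neg_neg]
        exact add_comm _ _
    obtain ⟨b, hb⟩ := hsmall _ hy''S hy''eig
    have hres : ∀ ρ ∈ torsionFixing (W.baseChange K) ((2 ^ (M + 1) : ℕ) : ℤ),
        h1Eval (W.baseChange K) ((2 ^ M : ℕ) : ℤ)
          (((2 : ℤ) ^ a) • (conjAct W τ ((2 ^ M : ℕ) : ℤ) y' + (-u) • y')) ρ = 0 := fun ρ hρ ↦ by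
      have h := hb ρ hρ
      rwa [Finset.univ_eq_empty, Finset.sum_empty, sub_zero] at h
    have hkill := localization_eq_zero_of_res_eq_zero W hK hKolq (hidx' q hqmem) v hv hres
    have e1 : loc (((2 : ℤ) ^ a) • (conjAct W τ ((2 ^ M : ℕ) : ℤ) y' + (-u) • y')) =
        (2 : ℤ) ^ a • (loc (conjAct W τ ((2 ^ M : ℕ) : ℤ) y') + loc ((-u) • y')) := by
      rw [map_zsmul, map_add]
    have e2 : loc ((-u) • y') = (-u) • loc y' := map_zsmul _ _ _
    have e3 : conjActPlace W τ ((2 ^ M : ℕ) : ℤ) hfix (loc y') = loc (conjAct W τ ((2 ^ M : ℕ) : ℤ) y') :=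
      conjActPlace_localization W τ _ hfix y'
    have hgoal : (2 : ℤ) ^ a • (conjActPlace W τ ((2 ^ M : ℕ) : ℤ) hfix (loc y') + (-u) • loc y') = 0 := by
      rw [e3, ← e2, ← e1]; exact hkill
    exact hgoal
  -- the signed supply in situ
  obtain ⟨t, htS, hteig, htne⟩ := RegularRefill.exists_eigen_mem_selmerF_of_symmetrised_cut W M ew hμ hadd₁ hadd₂ hgal
    halt hnondeg inv hK hD ι hM (e' * q) hc hkol hkM 𝒯' h𝒯' hperf hvan hSC hqmem' v hv hτ1 hfix hs hτe' (hconj τ)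
    (a := a) (by omega) hcut
  refine ⟨t, ?_, hteig, ?_⟩
  · rw [mul_comm q e', ← hS'eq]; exact htS
  · have hexp : M - (a + 7) - 1 = M - (a + 8) := by omega
    have hcast : ((2 ^ (M - (a + 7) - 1) : ℕ) : ℤ) = (2 : ℤ) ^ (M - (a + 8)) := by
      rw [hexp, Nat.cast_pow, Nat.cast_ofNat]
    rw [hcast]
    intro h0
    apply htne
    change (2 : ℤ) ^ (M - (a + 8)) • loc t = 0
    rw [← map_zsmul, h0, map_zero]

end Summit.BirchSwinnertonDyer.BirchSwinnertonDyer.Theorems.KolyvaginAtTwo.RegularWalk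

end
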